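import Summits.HodgeConjecture.HodgeConjecture.Theorems.Ring2AbelianAllWeilColumn
import Summits.HodgeConjecture.HodgeConjecture.Theorems.Ring2HypothesesCodimTwo
import Summits.HodgeConjecture.HodgeConjecture.Theorems.Ring2AbelianAllWeilFloorRebase
import Literature.ModelTheory.ExponentialFields.RealClosedFieldTheory
import HarnessLib

/-!
# Ring 2 around `HC_CM` — `HC(all abelian varieties) ⟸ HC_CM + B`, FRAME IV: the `E`-rank-4 column and its
junction with the route item `RankFourFaces.RankFourWeilClasses` (typer 1, cell LEAD)

HONEST FRAMING (page 1, verbatim in every file of this cell): research route conditional on HC_CM; not a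
corollary; Q11.4-sentence-2 already refuted in dim ≥ 3.
AbelianAll sub-cell line (F-ab-27): research route, not a corollary; conditional on HC_CM plus one named minimal statement.

`HC_CM` := `Theses.RankFourFaces.CMAbelianHodge` (item stmt-HodgeConjecture-3052) and `HC_AV` :=
`Theses.PadicSemiregularLift.HodgeAbelianVarieties` are OPEN; below they occur only as HYPOTHESES by name, inside the
grammar words of Frame I (`ClosesWithCM B := HC_CM → B → HC_AV`, `OnPathAV`, `ExactWithCM`, `CMIdle`), or as the
CONCLUSION of an implication all of whose open inputs are explicit binders. The printed theorems enter as the tree's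
NAMED FACTS taken as hypotheses (never asserted): `h𝔄 : Andre1992_hodgeClasses_cmAbelianVariety_mem_span_pullback_weilClasses`
(REFEREED), `h83 : Hazama2003_generalHodge_cmType_of_hodge_codimTwo` (REFEREED), and on the floor either the
CLAIM-tagged record `hF : Markman2025_weilClasses_algebraic_abelianFourfold` (F1, arXiv:2502.03415 Cor. 1.6.1,
UNREFEREED in general) or its refereed decomposition (Koike 2004, Schoen 1998, Markman 2023 + the typed Landherr /
van Geemen 5.2 obligations) plus the residual hypothesis `WeilFourfoldResidual` (ab-andre-1's `Ring2AbelianAllWeilFloor`).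
No `sorry`, no new definition, no new named fact.

THE SOURCES (first-hand quotations are in the records composed here; locators repeated for the reader).
* F. Hazama, Publ. RIMS 39 (2003), Thm. 8.3 p. 655: the general Hodge conjecture for abelian varieties of CM type
  follows from the usual Hodge conjecture for them "up to codimension two" [Hazama2003GHCCM]; J. S. Milne, AIM talk
  (arXiv:0709.3040) Thm. 8.5: "it suffices to prove it in codimension 2" [Milne2007TateFiniteFieldsAIM].
* Y. André 1992 as rendered by Charles–Schnell, Thm. 11.5.21 (p. 510): Hodge classes on a CM abelian variety are sums
  of pull-backs of split Weil classes of `E`-rank `2k` [Andre1992HodgeCM] [CharlesSchnell2014Notes].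
* B. Moonen, Yu. Zarhin, Duke Math. J. 77 (1995) / Weil classes (1998) §1: `W_E ⊗ ℂ = ⊕_σ ⋀^r V_{ℂ,σ}` — the tree's
  carrier `weilClassesField A φ P r`, "verbatim the carrier of the route item `RankFourFaces.RankFourWeilClasses`
  (`r = 4`)" (docstring of `HodgeTheory.weilClassesField`) [MoonenZarhin1998WeilClasses].
* A CM field has even degree; in the items' rendering ("no complex root of `P` is real") this is the intermediate
  value theorem for odd-degree real polynomials, the tree's `Real.exists_isRoot_of_odd_natDegree`
  [BochnakCosteRoy1998, Ex. 1.2.3].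

WHAT THIS FILE ADDS (nothing of hweil's ladder files, of parts XXII (typer 2, `Ring2HypothesesCodimTwo`), XIV (deform,
`Ring2DeformFrameRows` §D) or of ab-weil-1's `Ring2AbelianAllWeilColumn` is re-derived; their theorems are used BY NAME).
§R1 JUNCTION, count once across routes. The cell's price "(b) = codimension-2 Weil classes for CM fields of degree
  `e > 2`, `E`-rank 4, on every `B`" (`CodimTwoWeilClassesCMFieldOff (fun _ ↦ False)`, the `m = 2` slice of the ladder
  rung R3) IS, in the kernel, the ledger item stmt-HodgeConjecture-16268 `RankFourFaces.RankFourWeilClasses` (a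
  SUPPORT item of route RankFourFaces, filed 2026-08-16): `rankFourWeilClasses_iff_codimTwoWeilClassesCMField`. The
  two renderings differ by (i) `e = 2g, g ≥ 2` vs `e > 2` — bridged by `even_natDegree_of_forall_root_conj_ne` (odd `e`
  is excluded by "no real root"), (ii) `ρ.im ≠ 0` vs `conj ρ ≠ ρ`, `aeval` vs `eval₂ (algebraMap ℚ ℂ)`, `4` vs `2·2`,
  and the smooth-projective guard (provable for abelian varieties). Hence R3 ⟹ item 16268 by name.
§R2 ON PATH: F1's statement, the price off any class, and item 16268 are consequences of `HC_AV` (`OnPathAV`).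
§R3 ROUTE RankFourFaces, read through Hazama: granted `h𝔄`, `h83` and the fourfold floor, the route's SUPPORT item
  16268 gives its CRUX `CMAbelianHodge` (stmt-3052) and hence its crux `FaceReduction` (stmt-16266,
  `RankFourWeilTransport → CMAbelianHodge`) with the transport hypothesis unused
  (`HC_CM_of_andre_of_hazama_of_markmanFourfolds_of_rankFourWeilClasses`, `faceReduction_of_…`); refereed-floor form
  with `WeilFourfoldResidual`. CONDITIONAL on open inputs; nothing is closed; the route is not re-based here.
§R4 FRAME ROWS, the `E`-RANK-4 COLUMN (sharpens ab-weil-1's Weil column `iff_weilRungs_and_of_exactWithCM :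
  HC_AV ↔ R∞ ∧ R3 ∧ B` mod André): for every closing candidate `B`, `F1 → item 16268 → B → HC_AV` and
  `CMIdle (F1 ∧ item 16268 ∧ B)`; for every exact candidate, `HC_AV ↔ F1 ∧ item 16268 ∧ B` — mod André AND Hazama
  (one more refereed record buys `n = m = 2` in place of every `n`, `m`); least element `B = CMToAbelian`; the new
  right-hand side is implied by the old one (`rankFourInputs_of_weilRungs`).
§R5 AUDIT: everything HC-shaped here follows from `HodgeConjecture`; `h𝔄`, `h83` are structure theorems about CM Hodge
  rings, not consequences of HC, never asserted; no minimality is moved (RING2-MAP L10.3/L11.3 bottoms unchanged).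

§R6 (rev. 2) MEETING POINT D4 — ONE STATEMENT, THREE SPELLINGS, COUNTED ONCE (hodge-director 2026-08-19): "`E`-rank-4 Weil classes
  over a CM field are algebraic" is (i) the ledger item 16268 `RankFourFaces.RankFourWeilClasses` — CANONICAL; (ii) hweil's rung R3
  `WeilTypeLadder.WeilClassesCMField` at `m = 2` (local notation `R3⁽²⁾[]` below, body verbatim); (iii) the inline binder `h₃` of
  hodgecm's Literature theorem `cmHodgeHypothesisAt_of_rankFourWeil` (= the body of `R3⁽²⁾[]`, verbatim) — and typer 1's price
  `CodimTwoWeilClassesCMFieldOff (fun _ ↦ False)` is (ii) with a vacuous guard. Kernel: `rankFourWeilClasses_iff_weilClassesCMField_two`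
  (16268 ↔ R3⁽²⁾ = h₃), `weilClassesCMField_two_of_rankFourWeilClasses` (16268 ⇒ h₃), `weilClassesCMField_two_of_weilClassesCMField`
  (R3 ⇒ R3⁽²⁾), `weilFourfoldSlice_of_markmanFourfolds` (F1 ⇒ hodgecm's `h₂`), and hodgecm's theorem FED BY NAME from the item:
  `cmHodgeHypothesisAt_of_andre_of_hazama_of_markmanFourfolds_of_rankFourWeilClasses` (agrees with §R3 / typer 2 XXII, which inline the
  same two conversions). Cite (i) everywhere; (ii), (iii) and the price are reached from it by these names.

§R7 (rev. 3) THE REFEREED-FLOOR ROW RE-BASED (typer 2 XXIX's one-term re-base, owner's duty): §R3's row is re-stated WITHOUT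
  `(hE : PolarizedWeilDiscriminantExists)` (van Geemen 5.2 (1)–(3) = typer 2's tree theorem `polarizedWeilDiscriminantExists_holds`
  over lit's `VanGeemen1994.exists_projectiveEmbedding_hasWeilDiscriminantNondeg`), and with ab-weil-1's re-based floor
  (`Ring2AbelianAllWeilFloorRebase`) at the POSITIVE SQUAREFREE residual — the sharpest typed price of `HC_CM` on this column.
  Dated rows above unchanged; count once (discharge typer 2's, floor ab-weil-1's, junction §R3's).

References (bib keys): Hazama2003GHCCM (Thm. 8.3 p. 655), Milne2007TateFiniteFieldsAIM (Thm. 8.5), Andre1992HodgeCM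
(Théorème), CharlesSchnell2014Notes (Thm. 11.5.21 p. 510), MoonenZarhin1998WeilClasses (§1), Markman2025SecantWeil
(Cor. 1.6.1, UNREFEREED), Markman2025SurveySecant (Thm. 1.2, §12), Koike2004WeilHodge (Rem. 2.1),
Schoen1998HodgeWeilAddendum (§10), Markman2023GeneralizedKummers (Thm. 1.3), BochnakCosteRoy1998 (Ex. 1.2.3),
Weil1977HodgeRing, Deligne2000 (§1).
-/

set_option linter.dupNamespace false

noncomputable section

namespace Summit.HodgeConjecture.HodgeConjecture.Ring2.AbelianAll

open CategoryTheory
open Literature.AlgebraicGeometry Literature.AlgebraicGeometry.Motives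
open Literature.AlgebraicGeometry.HodgeTheory
open Summit.HodgeConjecture.HodgeConjecture
open Summit.HodgeConjecture.HodgeConjecture.Theses
open Summit.HodgeConjecture.HodgeConjecture.Theses.RankFourFaces (CMAbelianHodge CMToAbelian FaceReduction
  RankFourWeilClasses)
open Summit.HodgeConjecture.HodgeConjecture.Theses.PadicSemiregularLift (HodgeAbelianVarieties)
open Summit.HodgeConjecture.HodgeConjecture.WeilTypeLadder
open Summit.HodgeConjecture.HodgeConjecture.Ring2.Hypotheses
open Summit.HodgeConjecture.HodgeConjecture.Ring2.ClassTargets (CodimTwoWeilClassesCMFieldOff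
  codimTwoWeilClassesCMFieldOff_of_weilClassesCMField codimTwoWeilClassesCMFieldOff_of_hodgeAbelianVarieties HCOnClass)

/-! ## §R1 The junction: item stmt-16268 `RankFourWeilClasses` IS the codimension-2 CM-field Weil price -/

/-- **A polynomial `P ∈ ℤ[T]` none of whose complex roots is real has EVEN degree** (a CM field has even degree, in the
items' rendering): an odd-degree real polynomial has a real root (intermediate value theorem, the tree's
`Literature.ModelTheory.ExponentialFields.Real.exists_isRoot_of_odd_natDegree`). [cite: BochnakCosteRoy1998, Ex. 1.2.3] -/
theorem even_natDegree_of_forall_root_conj_ne (P : Polynomial ℤ)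
    (h : ∀ ρ : ℂ, Polynomial.eval₂ (Int.castRingHom ℂ) ρ P = 0 → starRingEnd ℂ ρ ≠ ρ) : Even P.natDegree := by
  rcases Nat.even_or_odd P.natDegree with he | ho
  · exact he
  exfalso
  have hdeg : (P.map (Int.castRingHom ℝ)).natDegree = P.natDegree :=
    Polynomial.natDegree_map_eq_of_injective (Int.castRingHom ℝ).injective_int P
  obtain ⟨x, hx⟩ := Literature.ModelTheory.ExponentialFields.Real.exists_isRoot_of_odd_natDegree
    (f := P.map (Int.castRingHom ℝ)) (by rw [hdeg]; exact ho)
  have hx' : Polynomial.eval₂ (Int.castRingHom ℝ) x P = 0 := by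
    rwa [Polynomial.IsRoot.def, Polynomial.eval_map] at hx
  refine h (x : ℂ) ?_ (Complex.conj_ofReal x)
  have hC := Polynomial.hom_eval₂ P (Int.castRingHom ℝ) (algebraMap ℝ ℂ) x
  rw [hx', map_zero, RingHom.ext_int ((algebraMap ℝ ℂ).comp (Int.castRingHom ℝ)) (Int.castRingHom ℂ)] at hC
  simpa using hC.symm

/-- **Item 16268 ⟹ the price (b) on every `B`.** Given `(B, ψ, P)` with `E = ℚ[T]/(P)` CM of degree `e > 2` and
`e · 4 = 2 dim B`: `e = 2g` is even (`even_natDegree_of_forall_root_conj_ne`), `g ≥ 2`, `dim B = 4g`, and the item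
applies verbatim on the carrier `weilClassesField B ψ P 4` (`HodgeTheory.mem_weilClassesField_iff`, definitional).
Both sides OPEN; an implication between hypotheses. [cite: MoonenZarhin1998WeilClasses, §1] -/
theorem codimTwoWeilClassesCMField_of_rankFourWeilClasses (h : RankFourWeilClasses) :
    CodimTwoWeilClassesCMFieldOff fun _ ↦ False := by
  intro B ψ P e hP hPe he hirr hev hdim hreal hQ _ w hw hwQ hwt
  obtain ⟨g, hg⟩ := even_natDegree_of_forall_root_conj_ne P hreal
  have hPg : P.natDegree = 2 * g := by omega
  have h2g : 2 ≤ g := by omega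
  have hB : B.dim = 4 * g := by omega
  have hX : IsSmoothProjective (4 * g) B.X := by
    rw [← hB]
    exact AbelianVariety.isSmoothProjective_holds
  have hwt' : IsOfHodgeType (4 * g) B.X 4 2 2 w := by
    rw [hB] at hwt
    exact hwt
  exact h g h2g P hP hPg hirr (fun ρ hρ him ↦ hreal ρ hρ (Complex.conj_eq_iff_im.mpr him))
    (hQ.imp fun Q hQ' ρ hρ ↦ by rw [Polynomial.aeval_def]; exact hQ' ρ hρ)
    B ψ hB hX hev w hwQ hwt' hw

/-- **The price (b) on every `B` ⟹ item 16268** (`e := 2g > 2`, `2g · 4 = 2 · 4g`; the item's smooth-projective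
guard is not needed). [cite: MoonenZarhin1998WeilClasses, §1] -/
theorem rankFourWeilClasses_of_codimTwoWeilClassesCMField (h₆ : CodimTwoWeilClassesCMFieldOff fun _ ↦ False) :
    RankFourWeilClasses := by
  intro g hg P hP hPg hirr hreal hQ A φ hA _hX hev c hcQ hct hc
  have hct' : IsOfHodgeType A.dim A.X (2 * 2) 2 2 c := by
    rw [hA]
    exact hct
  exact h₆ A φ P (2 * g) hP hPg (by omega) hirr hev (by rw [hA]; omega)
    (fun ρ hρ hc' ↦ hreal ρ hρ (Complex.conj_eq_iff_im.mp hc'))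
    (hQ.imp fun Q hQ' ρ hρ ↦ by rw [← Polynomial.aeval_def]; exact hQ' ρ hρ)
    not_false c hc hcQ hct'

/-- **JUNCTION (count once across routes): item stmt-HodgeConjecture-16268 `RankFourFaces.RankFourWeilClasses` ⟺ the
cell's codimension-2 CM-field Weil price on every abelian variety** (`E`-rank 4, every CM field `E` of degree `> 2`).
One ledger item, two renderings. [cite: MoonenZarhin1998WeilClasses, §1] [cite: Deligne1982HodgeCycles, §4–5] -/
theorem rankFourWeilClasses_iff_codimTwoWeilClassesCMField :
    RankFourWeilClasses ↔ CodimTwoWeilClassesCMFieldOff fun _ ↦ False :=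
  ⟨codimTwoWeilClassesCMField_of_rankFourWeilClasses, rankFourWeilClasses_of_codimTwoWeilClassesCMField⟩

/-- **R3 ⟹ item 16268** (the ladder rung `WeilTypeLadder.WeilClassesCMField`, every `m`, gives its `m = 2` slice, which is
the item): the R3 docstring's "verbatim the carrier of the route item" as a kernel implication.
[cite: MoonenZarhin1998WeilClasses, §1] [cite: Markman2025SurveySecant, §12] -/
theorem rankFourWeilClasses_of_weilClassesCMField (h₃ : WeilClassesCMField) : RankFourWeilClasses :=
  rankFourWeilClasses_of_codimTwoWeilClassesCMField (codimTwoWeilClassesCMFieldOff_of_weilClassesCMField h₃ _)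

/-- The `E`-rank-4 inputs are implied by the Weil rungs: `R∞ ∧ R3 → F1 ∧ item 16268` (R∞ at `n = 2` is F1's statement:
hweil's `WeilTypeLadder.floorFourfolds_of_weilClassesImaginaryQuadratic`, by name). [cite: Markman2025SurveySecant, Thm. 1.2 and §12] -/
theorem rankFourInputs_of_weilRungs (h : WeilClassesImaginaryQuadratic ∧ WeilClassesCMField) :
    Markman2025_weilClasses_algebraic_abelianFourfold ∧ RankFourWeilClasses :=
  ⟨floorFourfolds_of_weilClassesImaginaryQuadratic h.1, rankFourWeilClasses_of_weilClassesCMField h.2⟩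

/-! ## §R2 The `E`-rank-4 inputs are ON PATH (consequences of `HC_AV`) -/

/-- F1's statement is a consequence of `HC_AV` (a Weil-type fourfold is an abelian variety). [cite: Deligne2000, §1] -/
theorem onPathAV_markmanFourfolds : OnPathAV Markman2025_weilClasses_algebraic_abelianFourfold :=
  fun hAV d _ A φ hA _ _ c hc hct _ ↦ by
    have h : HodgeConjectureFor A.dim A.X := hAV A
    rw [hA] at h
    exact h.2 2 c hc hct

/-- The price off any class is a consequence of `HC_AV` (typer 1's `codimTwoWeilClassesCMFieldOff_of_hodgeAbelianVarieties`,
in the grammar's word). [cite: Deligne2000, §1] -/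
theorem onPathAV_codimTwoWeilClassesCMFieldOff (𝒞 : AbelianVariety ℂ → Prop) :
    OnPathAV (CodimTwoWeilClassesCMFieldOff 𝒞) :=
  fun hAV ↦ codimTwoWeilClassesCMFieldOff_of_hodgeAbelianVarieties hAV 𝒞

/-- Item 16268 is a consequence of `HC_AV`. [cite: Deligne2000, §1] -/
theorem onPathAV_rankFourWeilClasses : OnPathAV RankFourWeilClasses :=
  onPathAV_monotone rankFourWeilClasses_of_codimTwoWeilClassesCMField (onPathAV_codimTwoWeilClassesCMFieldOff _)

/-! ## §R3 Route RankFourFaces read through Hazama: the support item gives the CM cruxes, granted the records and the floor -/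

/-- **`HC_CM` (item stmt-3052, by name) ⟸ André 1992 + Hazama 2003 + F1 + item 16268** (typer 2's
`hc_cm_of_andre_of_hazama_of_weilClassesFourfolds_of_codimTwoCMField` through the junction §R1). `HC_CM` is the
CONCLUSION; every input is a binder; F1 is UNREFEREED in general. [cite: Hazama2003GHCCM, Thm. 8.3 p. 655]
[cite: CharlesSchnell2014Notes, Thm. 11.5.21 (p. 510)] [cite: Markman2025SecantWeil, Cor. 1.6.1] -/
theorem HC_CM_of_andre_of_hazama_of_markmanFourfolds_of_rankFourWeilClasses
    (h𝔄 : Andre1992_hodgeClasses_cmAbelianVariety_mem_span_pullback_weilClasses)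
    (h83 : Hazama2003_generalHodge_cmType_of_hodge_codimTwo)
    (hF : Markman2025_weilClasses_algebraic_abelianFourfold) (hR4 : RankFourWeilClasses) : CMAbelianHodge :=
  hc_cm_of_andre_of_hazama_of_weilClassesFourfolds_of_codimTwoCMField h𝔄 h83 hF
    (codimTwoWeilClassesCMField_of_rankFourWeilClasses hR4)

/-- **The same with the REFEREED floor** (Koike 2004 `d = 1`, Schoen 1998 `d = 3`, Markman 2023 + Landherr for split
`δ`, van Geemen 5.2 typed) **and the residual hypothesis `WeilFourfoldResidual`** in place of F1 (ab-andre-1's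
`markmanFourfolds_of_refereed_and_residual`). [cite: Koike2004WeilHodge, Rem. 2.1] [cite: Schoen1998HodgeWeilAddendum, §10]
[cite: Markman2023GeneralizedKummers, Thm. 1.3] [cite: Hazama2003GHCCM, Thm. 8.3 p. 655] -/
theorem HC_CM_of_andre_of_hazama_of_refereedFloor_of_residual_of_rankFourWeilClasses
    (h𝔄 : Andre1992_hodgeClasses_cmAbelianVariety_mem_span_pullback_weilClasses)
    (h83 : Hazama2003_generalHodge_cmType_of_hodge_codimTwo)
    (hK : Koike2004_weilClasses_algebraic_hyperbolicSixfold_one)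
    (hS : Schoen1998_weilClasses_algebraic_hyperbolicSixfold_three)
    (hL : LandherrSplitCriterion) (hM23 : Markman2023_weilClasses_algebraic_discOneWeilFourfold)
    (hE : PolarizedWeilDiscriminantExists) (hR : WeilFourfoldResidual) (hR4 : RankFourWeilClasses) : CMAbelianHodge :=
  HC_CM_of_andre_of_hazama_of_markmanFourfolds_of_rankFourWeilClasses h𝔄 h83
    (markmanFourfolds_of_refereed_and_residual hK hS hL hM23 hE hR) hR4

/-- **Route RankFourFaces: its crux `FaceReduction` (stmt-16266, `RankFourWeilTransport → CMAbelianHodge`) follows from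
its SUPPORT item 16268, granted André, Hazama and F1 — the transport hypothesis is not used.** A re-pricing of the
route's CM sector by print (Hazama's Thm. 8.3 in place of the 2001 lattice theorem); CONDITIONAL on open inputs, the
route is not re-based here. [cite: Hazama2003GHCCM, Thm. 8.3 p. 655] [cite: CharlesSchnell2014Notes, Thm. 11.5.21 (p. 510)] -/
theorem faceReduction_of_andre_of_hazama_of_markmanFourfolds_of_rankFourWeilClasses
    (h𝔄 : Andre1992_hodgeClasses_cmAbelianVariety_mem_span_pullback_weilClasses)
    (h83 : Hazama2003_generalHodge_cmType_of_hodge_codimTwo)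
    (hF : Markman2025_weilClasses_algebraic_abelianFourfold) (hR4 : RankFourWeilClasses) : FaceReduction :=
  fun _ ↦ HC_CM_of_andre_of_hazama_of_markmanFourfolds_of_rankFourWeilClasses h𝔄 h83 hF hR4

/-! ## §R4 Frame rows: the `E`-rank-4 column (`n = m = 2` in place of the Weil rungs R∞, R3) -/

/-- **`HC_CM`-FREE TWIN of a closing row, `E`-rank 4.** If `HC_CM → B → HC_AV` (`ClosesWithCM B`), then
`F1 → item 16268 → B → HC_AV` modulo André 1992 and Hazama 2003 (compare ab-weil-1's `HC_AV_of_closesWithCM_of_weilRungs`: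
R∞, R3, André only). [cite: Hazama2003GHCCM, Thm. 8.3 p. 655] [cite: Andre1992HodgeCM, Théorème] -/
theorem HC_AV_of_closesWithCM_of_rankFour {B : Prop} (hB : ClosesWithCM B)
    (h𝔄 : Andre1992_hodgeClasses_cmAbelianVariety_mem_span_pullback_weilClasses)
    (h83 : Hazama2003_generalHodge_cmType_of_hodge_codimTwo)
    (hF : Markman2025_weilClasses_algebraic_abelianFourfold) (hR4 : RankFourWeilClasses) (b : B) :
    HodgeAbelianVarieties :=
  hB (HC_CM_of_andre_of_hazama_of_markmanFourfolds_of_rankFourWeilClasses h𝔄 h83 hF hR4) b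

/-- In the grammar's words: next to the `E`-rank-4 inputs, `HC_CM` is IDLE for every closing candidate —
`CMIdle (F1 ∧ item 16268 ∧ B)`, the typed dominators being André 1992 and Hazama 2003. [cite: Hazama2003GHCCM, Thm. 8.3 p. 655] -/
theorem cmIdle_rankFour_and_of_closesWithCM {B : Prop} (hB : ClosesWithCM B)
    (h𝔄 : Andre1992_hodgeClasses_cmAbelianVariety_mem_span_pullback_weilClasses)
    (h83 : Hazama2003_generalHodge_cmType_of_hodge_codimTwo) :
    CMIdle (Markman2025_weilClasses_algebraic_abelianFourfold ∧ RankFourWeilClasses ∧ B) :=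
  fun h ↦ HC_AV_of_closesWithCM_of_rankFour hB h𝔄 h83 h.1 h.2.1 h.2.2

/-- **Exactness with the `E`-rank-4 inputs in place of `HC_CM`.** For every EXACT candidate (`HC_AV ↔ HC_CM ∧ B`):
`HC_AV ↔ F1 ∧ item 16268 ∧ B`, modulo André 1992 and Hazama 2003 (`→` unconditional: §R2). Sharpens
`iff_weilRungs_and_of_exactWithCM` (`R∞ ∧ R3 ∧ B`, mod André) by `rankFourInputs_of_weilRungs`, at the cost of one more
refereed record. [cite: Hazama2003GHCCM, Thm. 8.3 p. 655] [cite: CharlesSchnell2014Notes, Thm. 11.5.21 (p. 510)] -/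
theorem iff_rankFour_and_of_exactWithCM {B : Prop} (hB : ExactWithCM B)
    (h𝔄 : Andre1992_hodgeClasses_cmAbelianVariety_mem_span_pullback_weilClasses)
    (h83 : Hazama2003_generalHodge_cmType_of_hodge_codimTwo) :
    HodgeAbelianVarieties ↔ (Markman2025_weilClasses_algebraic_abelianFourfold ∧ RankFourWeilClasses ∧ B) :=
  ⟨fun h ↦ ⟨onPathAV_markmanFourfolds h, onPathAV_rankFourWeilClasses h, (exactWithCM_iff.1 hB).2 h⟩,
    cmIdle_rankFour_and_of_closesWithCM (exactWithCM_iff.1 hB).1 h𝔄 h83⟩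

/-- Least element: `HC_AV ↔ F1 ∧ item 16268 ∧ item 16267 (CMToAbelian)`, modulo André 1992 and Hazama 2003 (compare
typer 2's `cmToAbelian_iff_hodgeAbelianVarieties_of_andre_of_hazama_of_weilClassesFourfolds_of_codimTwoCMField`, which
takes F1 and the price as hypotheses). [cite: Hazama2003GHCCM, Thm. 8.3 p. 655] [cite: Andre1992HodgeCM, Théorème] -/
theorem iff_rankFour_and_cmToAbelian
    (h𝔄 : Andre1992_hodgeClasses_cmAbelianVariety_mem_span_pullback_weilClasses)
    (h83 : Hazama2003_generalHodge_cmType_of_hodge_codimTwo) :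
    HodgeAbelianVarieties ↔ (Markman2025_weilClasses_algebraic_abelianFourfold ∧ RankFourWeilClasses ∧ CMToAbelian) :=
  iff_rankFour_and_of_exactWithCM exactWithCM_cmToAbelian h𝔄 h83

/-- The class axis under a closing candidate, `HC_CM` traded for the `E`-rank-4 inputs: `F1 → item 16268 → B → HC⟨𝒞⟩` for
every class `𝒞`, modulo André and Hazama (Frame I's `hcOnClass_of_closesWithCM`). [cite: Hazama2003GHCCM, Thm. 8.3 p. 655] -/
theorem hcOnClass_of_closesWithCM_of_rankFour {B : Prop} (hB : ClosesWithCM B)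
    (h𝔄 : Andre1992_hodgeClasses_cmAbelianVariety_mem_span_pullback_weilClasses)
    (h83 : Hazama2003_generalHodge_cmType_of_hodge_codimTwo)
    (hF : Markman2025_weilClasses_algebraic_abelianFourfold) (hR4 : RankFourWeilClasses) (b : B)
    (𝒞 : AbelianVariety ℂ → Prop) : HCOnClass 𝒞 :=
  hcOnClass_of_closesWithCM hB (HC_CM_of_andre_of_hazama_of_markmanFourfolds_of_rankFourWeilClasses h𝔄 h83 hF hR4) b 𝒞

/-! ## §R5 Audit: every HC-shaped statement of this file is on-path -/

/-- Audit: F1, item 16268, the price on every `B` and `HC_CM` follow from `HodgeConjecture` (upper bound; none is claimed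
as progress); André's and Hazama's records are never asserted. [cite: Deligne2000, §1] -/
theorem rankFourColumn_of_hodgeConjecture (h : _root_.HodgeConjecture) :
    Markman2025_weilClasses_algebraic_abelianFourfold ∧ RankFourWeilClasses ∧
      (CodimTwoWeilClassesCMFieldOff fun _ ↦ False) ∧ CMAbelianHodge :=
  ⟨(codimTwoInputs_of_hodgeConjecture h fun _ ↦ False).2.1,
    rankFourWeilClasses_of_codimTwoWeilClassesCMField (codimTwoInputs_of_hodgeConjecture h fun _ ↦ False).2.2.1,
    (codimTwoInputs_of_hodgeConjecture h fun _ ↦ False).2.2.1, Ring2.Deform.HC_CM_of_hodgeConjecture h⟩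

/-! ## §R6 (rev. 2) Meeting point D4: item 16268 is CANONICAL — the three spellings agree by name -/

/-- `R3⁽²⁾[]` — hweil's rung R3 `WeilTypeLadder.WeilClassesCMField` at `m = 2`; its body is VERBATIM the inline binder `h₃` of
hodgecm's `cmHodgeHypothesisAt_of_rankFourWeil` (`Literature/…/CMHodgeOfRankFourWeilClasses.lean`). Local notation, no new def. -/
local notation3 (prettyPrint := false) "R3⁽²⁾[]" =>
  ∀ (B : AbelianVariety ℂ) (ψ : B ⟶ B) (P : Polynomial ℤ) (e : ℕ),
    P.Monic → P.natDegree = e → 2 < e → Irreducible (P.map (Int.castRingHom ℚ)) →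
    Polynomial.eval₂ (Int.castRingHom (CategoryTheory.End B)) (ψ : CategoryTheory.End B) P = 0 →
    e * (2 * 2) = 2 * B.dim →
    (∀ ρ : ℂ, Polynomial.eval₂ (Int.castRingHom ℂ) ρ P = 0 → starRingEnd ℂ ρ ≠ ρ) →
    (∃ Q : Polynomial ℚ, ∀ ρ : ℂ, Polynomial.eval₂ (Int.castRingHom ℂ) ρ P = 0 →
        Polynomial.eval₂ (algebraMap ℚ ℂ) ρ Q = starRingEnd ℂ ρ) →
      ∀ w ∈ weilClassesField B ψ P (2 * 2), IsRationalClass w →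
        IsOfHodgeType B.dim B.X (2 * 2) 2 2 w → w ∈ algebraicClasses B.X 2

/-- `F1⁽ʰ²⁾[]` — the fourfold floor WITHOUT the smooth-projective guard: VERBATIM hodgecm's inline binder `h₂`. Local notation. -/
local notation3 (prettyPrint := false) "F1⁽ʰ²⁾[]" =>
  ∀ (d : ℕ), 0 < d → ∀ (B : AbelianVariety ℂ) (ψ : B ⟶ B), B.dim = 2 * 2 →
    ψ ≫ ψ = -(d • 𝟙 B) → ∀ w : complexBetti B.X (2 * 2), IsRationalClass w →
      IsOfHodgeType (2 * 2) B.X (2 * 2) 2 2 w → w ∈ weilClassesOf B ψ 2 d → w ∈ algebraicClasses B.X 2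

/-- The cell's price off every class is R3⁽²⁾ (its guard `¬ False` is vacuous). [cite: MoonenZarhin1998WeilClasses, §1] -/
theorem codimTwoWeilClassesCMFieldOff_false_iff_weilClassesCMField_two :
    CodimTwoWeilClassesCMFieldOff (fun _ ↦ False) ↔ R3⁽²⁾[] :=
  ⟨fun h B ψ P e hP he h2 hirr hψ hdim hρ hQ w hw hc hH ↦ h B ψ P e hP he h2 hirr hψ hdim hρ hQ (fun h ↦ h) w hw hc hH,
    fun h B ψ P e hP he h2 hirr hψ hdim hρ hQ _ w hw hc hH ↦ h B ψ P e hP he h2 hirr hψ hdim hρ hQ w hw hc hH⟩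

/-- **Item 16268 ↔ R3 at `m = 2` (= hodgecm's `h₃`)** — the by-name meeting point of the three spellings; 16268 is canonical.
[cite: MoonenZarhin1998WeilClasses, §1] [cite: BochnakCosteRoy1998, Ex. 1.2.3] -/
theorem rankFourWeilClasses_iff_weilClassesCMField_two : RankFourWeilClasses ↔ R3⁽²⁾[] :=
  rankFourWeilClasses_iff_codimTwoWeilClassesCMField.trans codimTwoWeilClassesCMFieldOff_false_iff_weilClassesCMField_two

/-- **Item 16268 ⇒ `h₃`** (the direction the compositions consume). [cite: MoonenZarhin1998WeilClasses, §1] -/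
theorem weilClassesCMField_two_of_rankFourWeilClasses (h : RankFourWeilClasses) : R3⁽²⁾[] :=
  rankFourWeilClasses_iff_weilClassesCMField_two.1 h

/-- hweil's rung R3 (every `m`) specialises to R3⁽²⁾; with `rankFourWeilClasses_of_weilClassesCMField` (§R1) the ladder reaches the
item by name. [cite: MoonenZarhin1998WeilClasses, §1] -/
theorem weilClassesCMField_two_of_weilClassesCMField (h : WeilClassesCMField) : R3⁽²⁾[] :=
  fun B ψ P e hP he h2 hirr hψ hdim hρ hQ w hw hc hH ↦ h B ψ P e 2 hP he h2 hirr hψ hdim hρ hQ w hw hc hH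

/-- F1 ⇒ hodgecm's `h₂` (drop the smooth-projective guard, provable for abelian varieties: typer 2's
`isSmoothProjective_two_mul_two_of_dim`). [cite: Markman2025SecantWeil, Cor. 1.6.1 (UNREFEREED)] -/
theorem weilFourfoldSlice_of_markmanFourfolds (hF : Markman2025_weilClasses_algebraic_abelianFourfold) : F1⁽ʰ²⁾[] :=
  fun d hd B ψ hB hψ w hw hwt hweil ↦ hF d hd B ψ hB (isSmoothProjective_two_mul_two_of_dim hB) hψ w hw hwt hweil

/-- **hodgecm's Literature theorem fed BY NAME from the item**: `h𝔄 → h83 → F1 → item 16268 → ∀ A, CMHodgeHypothesisAt A`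
through `cmHodgeHypothesisAt_of_rankFourWeil` — the same statement as §R3's `HC_CM_of_andre_of_hazama_of_markmanFourfolds_of_
rankFourWeilClasses` (typer 2 XXII inlines the same two conversions); recorded so that hodgecm, hweil and this cell count the
`E`-rank-4 input ONCE, as item 16268. [cite: Hazama2003GHCCM, Thm. 8.3 (p. 655)] [cite: CharlesSchnell2014Notes, Thm. 11.5.21 (p. 510)] -/
theorem cmHodgeHypothesisAt_of_andre_of_hazama_of_markmanFourfolds_of_rankFourWeilClasses
    (h𝔄 : Andre1992_hodgeClasses_cmAbelianVariety_mem_span_pullback_weilClasses)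
    (h83 : Hazama2003_generalHodge_cmType_of_hodge_codimTwo)
    (hF : Markman2025_weilClasses_algebraic_abelianFourfold) (hR4 : RankFourWeilClasses) (A : AbelianVariety ℂ) :
    Milne1999.CMHodgeHypothesisAt A :=
  cmHodgeHypothesisAt_of_rankFourWeil h𝔄 h83 (weilFourfoldSlice_of_markmanFourfolds hF)
    (weilClassesCMField_two_of_rankFourWeilClasses hR4) A

/-- The two routes to `HC_CM` from the four inputs agree: §R3's (via typer 2 XXII) and §R6's (via hodgecm's Literature theorem)
prove the same proposition (`cmAbelianHodge_iff_forall_cmHodgeHypothesisAt`, typer 2). [cite: Hazama2003GHCCM, Thm. 8.3 (p. 655)] -/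
theorem HC_CM_of_andre_of_hazama_of_markmanFourfolds_of_rankFourWeilClasses'
    (h𝔄 : Andre1992_hodgeClasses_cmAbelianVariety_mem_span_pullback_weilClasses)
    (h83 : Hazama2003_generalHodge_cmType_of_hodge_codimTwo)
    (hF : Markman2025_weilClasses_algebraic_abelianFourfold) (hR4 : RankFourWeilClasses) : CMAbelianHodge :=
  cmAbelianHodge_iff_forall_cmHodgeHypothesisAt.mpr
    (cmHodgeHypothesisAt_of_andre_of_hazama_of_markmanFourfolds_of_rankFourWeilClasses h𝔄 h83 hF hR4)

/-! ## §R7 (rev. 3) The refereed-floor row RE-BASED: no van Geemen 5.2 binder; the positive squarefree residual -/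

open Literature.AlgebraicGeometry.VanGeemen1994 (weilNormResidueGroup)

/-- **§R3's refereed-floor row WITHOUT the van Geemen binder** (`hE` is typer 2's tree theorem
`polarizedWeilDiscriminantExists_holds`; the floor is ab-weil-1's `markmanFourfolds_of_refereed_and_residual'`). CONDITIONAL on
open inputs; nothing is closed. [cite: vanGeemen1994HodgeAV, Lemma 5.2 (1)–(3)] [cite: Hazama2003GHCCM, Thm. 8.3 p. 655] -/
theorem HC_CM_of_andre_of_hazama_of_refereedFloor_of_residual_of_rankFourWeilClasses'
    (h𝔄 : Andre1992_hodgeClasses_cmAbelianVariety_mem_span_pullback_weilClasses)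
    (h83 : Hazama2003_generalHodge_cmType_of_hodge_codimTwo)
    (hK : Koike2004_weilClasses_algebraic_hyperbolicSixfold_one)
    (hS : Schoen1998_weilClasses_algebraic_hyperbolicSixfold_three)
    (hL : LandherrSplitCriterion) (hM23 : Markman2023_weilClasses_algebraic_discOneWeilFourfold)
    (hR : WeilFourfoldResidual) (hR4 : RankFourWeilClasses) : CMAbelianHodge :=
  HC_CM_of_andre_of_hazama_of_markmanFourfolds_of_rankFourWeilClasses h𝔄 h83
    (markmanFourfolds_of_refereed_and_residual' hK hS hL hM23 hR) hR4

/-- **The sharpest typed price of `HC_CM` on the `E`-rank-4 column**: André 1992 and Hazama 2003 (refereed), the refereed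
floor (Koike 2004, Schoen 1998, Markman 2023), Landherr's criterion, the POSITIVE SQUAREFREE fourfold residual — cells
`(2, d, δ)`, `d` squarefree `∉ {1, 3}`, `δ ≠ [1]`, `weilSign d δ = 1` (ab-weil-1's `markmanFourfolds_of_refereed_and_positive_residualSq`;
in print Markman 2025 Cor. 1.6.1, UNREFEREED) — and item 16268; `fun _ ↦ this` is the route crux `FaceReduction` (stmt-16266)
at the same price. CONDITIONAL; nothing is closed. [cite: vanGeemen1994HodgeAV, Lemma 5.2 (4) and 4.14]
[cite: Markman2025SecantWeil, Cor. 1.6.1 (preprint, unrefereed)] [cite: Hazama2003GHCCM, Thm. 8.3 p. 655] -/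
theorem HC_CM_of_andre_of_hazama_of_refereedFloor_of_positive_residualSq_of_rankFourWeilClasses
    (h𝔄 : Andre1992_hodgeClasses_cmAbelianVariety_mem_span_pullback_weilClasses)
    (h83 : Hazama2003_generalHodge_cmType_of_hodge_codimTwo)
    (hK : Koike2004_weilClasses_algebraic_hyperbolicSixfold_one)
    (hS : Schoen1998_weilClasses_algebraic_hyperbolicSixfold_three)
    (hL : LandherrSplitCriterion) (hM23 : Markman2023_weilClasses_algebraic_discOneWeilFourfold)
    (hR : ∀ d : ℕ, 0 < d → Squarefree d → d ≠ 1 → d ≠ 3 → ∀ δ : weilNormResidueGroup d,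
      δ ≠ splitDiscriminantClass 2 d → weilSign d δ = 1 → WeilClassesComponent 2 d δ)
    (hR4 : RankFourWeilClasses) : CMAbelianHodge :=
  HC_CM_of_andre_of_hazama_of_markmanFourfolds_of_rankFourWeilClasses h𝔄 h83
    (markmanFourfolds_of_refereed_and_positive_residualSq hK hS hL hM23 hR) hR4

end Summit.HodgeConjecture.HodgeConjecture.Ring2.AbelianAll

end
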